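import Summits.Ventures.WeilGRH.SelbergLatticeMinorant
import Summits.Ventures.WeilGRH.FlatWindowAtoms
import Summits.Ventures.WeilGRH.TwistedModulatedFlatTest
import Summits.RiemannHypothesis.RiemannHypothesis.Theorems.WeilBochnerMeasureWindow
import Summits.RiemannHypothesis.RiemannHypothesis.Theorems.WeilBochnerMeasureCounting
import Summits.RiemannHypothesis.RiemannHypothesis.Theorems.WeilFormatCWindowSesq
import HarnessLib

/-!
# rh-explicit (venture WeilGRH): THE WINDOW LAW IS A BEURLING–SELBERG LAW — the spectral mass of every Weil
  measure on a lattice window is bracketed by `N ± 1` window forms and ONE Gram cross term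

Cell `rh-explicit`, WEIL TRACK (structure seat weil-3, gen13).  Measure level, RH-free.

Let `a > 0` and let `μ` be ANY positive measure representing Weil's form on the tests of `[-a, a]`
(`W(g ⋆ g̃) = ∫ ‖ĝ(½+it)‖² dμ`; such `μ` exist iff the rung `WeilPositivityOn a` holds, e.g. unconditionally for
`a ≤ 4023/5000`).  Let `u_c = e^{−icx}χ_0` (`χ_0 = (2a)^{-1/2}𝟙_{[-a,a]}`) be the flat window modulated to height
`c`; on the critical line `û_c(½+it) = √(2a)·sinc(a(t − c))` (`weilMellin_modulated_eq_sinc`).  For the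
LATTICE heights `c_m = c + mπ/a` the `N + 2` functions `‖û_{c_m}‖²` (`0 ≤ m ≤ N`) and `û_{c_0}·û_{c_N}` are,
after `y = a(t−c)/π`, exactly `2a` times the finite `sinc` forms of `SelbergLatticeMinorant.lean` — the
Beurling–Selberg extremal majorant / minorant of the window `[c, c + Nπ/a]` of exponential type `2a`.
Integrating against `μ` (each `∫‖û_{c_m}‖²dμ` is the window form `W_a(u_{c_m})`, and
`∫ Re(û_{c_0} conj û_{c_N}) dμ = Re W_a(u_{c_0}, u_{c_N})`, the SESQUILINEAR window form, by polarisation):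

* **`two_mul_mul_measureReal_Icc_le_selberg`** (upper):
  `2a·μ[c, c + Nπ/a] ≤ Σ_{m=0}^{N} W_a(u_{c_m}) − (−1)^N N · Re W_a(u_c, u_{c+Nπ/a})`;
* **`selberg_le_two_mul_mul_measureReal_Ioo`** (lower):
  `Σ_{m=1}^{N−1} W_a(u_{c_m}) − (−1)^N N · Re W_a(u_c, u_{c+Nπ/a}) ≤ 2a·μ(c, c + Nπ/a)`,

for every `c ∈ ℝ` and every `N ∈ ℕ`.  `N = 0` (upper) is the atom bound `2a·μ{c} ≤ W_a(u_c)` of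
`ZetaWindowAtomsLimit`; `N = 1` (upper) improves Jordan's block bound `(8a/π²)μ[c ± π/2a] ≤ W`; `N = 2` (lower)
is a no-gap law with main coefficient `1·log(c/2π)` (gen12's block route gave `0.43`); `N → ∞` recovers the
Riemann–von Mangoldt coefficient `1/2π` on both sides up to `(1 ± 1/N)` — the Beurling–Selberg constants.
When `c ∈ (π/a)ℤ` all entries are Yoshida Gram entries `W_a(χ_m, χ_n)` of format C.  The cross term is put in
closed form and bounded in `WeilSelbergCrossTerm.lean`; explicit laws in `WeilSelbergWindowLaw.lean`.

No definitions, no named facts; RH-free.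
-/

set_option autoImplicit false

noncomputable section

open Complex Filter Set MeasureTheory
open scoped Real Topology ContDiff ComplexConjugate

namespace Summit.Ventures.WeilGRH

open Literature.NumberTheory.LFunctions
open Literature.NumberTheory.LFunctions.Yoshida1992 (chi chiCore)
open Summit.RiemannHypothesis.RiemannHypothesis.Theorems.WeilFormatC
open Summit.RiemannHypothesis.RiemannHypothesis.Theorems.WeilBochnerMeasure (weilWindowForm_eq_integral
  integrable_inv_one_add_sq measure_Icc_lt_top)

variable {a : ℝ}

/-! ## The modulated flat window on the critical line: `û_c(½+it) = √(2a)·sinc(a(t−c))` -/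

/-- **`û_c(½+it) = √(2a)·sinc(a(t − c))`** for the flat window modulated to height `c` — one formula at every `t`. -/
theorem weilMellin_modulated_eq_sinc (ha : 0 < a) (c t : ℝ) :
    weilMellin (fun x ↦ cexp (I * ((-c) * x : ℝ)) * chi a 0 x) (1 / 2 + t * I) =
      ((Real.sqrt (2 * a) * Real.sinc (a * (t - c)) : ℝ) : ℂ) := by
  rw [weilMellin_modulated_chi_zero]
  have h2a : (0 : ℝ) < 2 * a := by linarith
  have hsq : Real.sqrt (2 * a) ^ 2 = 2 * a := Real.sq_sqrt h2a.le
  have hs0 : Real.sqrt (2 * a) ≠ 0 := (Real.sqrt_pos.2 h2a).ne'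
  rcases eq_or_ne (t + -c) 0 with h | h
  · rw [h, weilMellin_chi_zero_zero ha, show t - c = 0 by linarith, mul_zero, Real.sinc_zero, mul_one]
  · rw [weilMellin_chi_zero ha h, show t - c = t + -c by ring]
    have hne : a * (t + -c) ≠ 0 := mul_ne_zero ha.ne' h
    rw [Real.sinc_of_ne_zero hne]
    congr 1
    field_simp
    rw [hsq]
    ring

/-- **`‖û_c(½+it)‖² = 2a·sinc²(a(t − c))`** (the Fejér profile centred at `c`). -/
theorem norm_sq_weilMellin_modulated_eq_sinc_sq (ha : 0 < a) (c t : ℝ) :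
    ‖weilMellin (fun x ↦ cexp (I * ((-c) * x : ℝ)) * chi a 0 x) (1 / 2 + t * I)‖ ^ 2 =
      2 * a * Real.sinc (a * (t - c)) ^ 2 := by
  rw [weilMellin_modulated_eq_sinc ha, Complex.norm_real, Real.norm_eq_abs, sq_abs, mul_pow,
    Real.sq_sqrt (by linarith)]

/-- **The cross profile**: `û_c(½+it)·conj(û_{c'}(½+it)) = 2a·sinc(a(t−c))·sinc(a(t−c'))` (a real number). -/
theorem weilMellin_modulated_mul_conj (ha : 0 < a) (c c' t : ℝ) :
    weilMellin (fun x ↦ cexp (I * ((-c) * x : ℝ)) * chi a 0 x) (1 / 2 + t * I) *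
        conj (weilMellin (fun x ↦ cexp (I * ((-c') * x : ℝ)) * chi a 0 x) (1 / 2 + t * I)) =
      ((2 * a * Real.sinc (a * (t - c)) * Real.sinc (a * (t - c')) : ℝ) : ℂ) := by
  rw [weilMellin_modulated_eq_sinc ha, weilMellin_modulated_eq_sinc ha, Complex.conj_ofReal, ← Complex.ofReal_mul]
  congr 1
  have hsq : Real.sqrt (2 * a) ^ 2 = 2 * a := Real.sq_sqrt (by linarith)
  rw [show Real.sqrt (2 * a) * Real.sinc (a * (t - c)) * (Real.sqrt (2 * a) * Real.sinc (a * (t - c'))) =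
    Real.sqrt (2 * a) ^ 2 * (Real.sinc (a * (t - c)) * Real.sinc (a * (t - c'))) by ring, hsq]
  ring

/-! ## Window functions: the modulated flat windows and their sums -/

/-- `weilMellin` is additive on window functions at points of the critical line. -/
theorem weilMellin_add_of_isWindowFunction {u v : ℝ → ℂ} (hu : IsWindowFunction a u)
    (hv : IsWindowFunction a v) (t : ℝ) :
    weilMellin (u + v) (1 / 2 + t * I) = weilMellin u (1 / 2 + t * I) + weilMellin v (1 / 2 + t * I) := by
  unfold weilMellin
  have hw : Continuous fun x : ℝ ↦ cexp ((1 / 2 + (t : ℂ) * I - 1 / 2) * (x : ℂ)) := by fun_prop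
  rw [← integral_add (hu.integrable_mul_continuous hw) (hv.integrable_mul_continuous hw)]
  exact integral_congr_ae (Eventually.of_forall fun x ↦ by simp only [Pi.add_apply, add_mul])

/-- `weilMellin` commutes with scalars (no hypothesis). -/
theorem weilMellin_smul (κ : ℂ) (u : ℝ → ℂ) (s : ℂ) : weilMellin (κ • u) s = κ * weilMellin u s := by
  unfold weilMellin
  rw [← integral_const_mul]
  exact integral_congr_ae (Eventually.of_forall fun x ↦ by simp only [Pi.smul_apply, smul_eq_mul, mul_assoc])

/-- The right slot of the sesquilinear window form is additive on window functions (`a ≥ 0`). -/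
theorem weilWindowSesq_add_right (ha : 0 ≤ a) {u v w : ℝ → ℂ} (hu : IsWindowFunction a u)
    (hv : IsWindowFunction a v) (hw : IsWindowFunction a w) :
    weilWindowSesq a w (u + v) = weilWindowSesq a w u + weilWindowSesq a w v := by
  rw [weilWindowSesq_conj_symm a (u + v) w, weilWindowSesq_add_left ha hu hv hw, map_add,
    ← weilWindowSesq_conj_symm, ← weilWindowSesq_conj_symm]

/-- The right slot is conjugate-homogeneous (no hypothesis). -/
theorem weilWindowSesq_smul_right (κ : ℂ) (u w : ℝ → ℂ) :
    weilWindowSesq a w (κ • u) = conj κ * weilWindowSesq a w u := by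
  rw [weilWindowSesq_conj_symm a (κ • u) w, weilWindowSesq_smul_left, map_mul, ← weilWindowSesq_conj_symm]

/-- **Polarisation of the window form** on window functions:
`W_a(u + v) − W_a(u − v) = 4·Re W_a(u, v)`. -/
theorem weilWindowForm_add_sub_weilWindowForm_sub (ha : 0 ≤ a) {u v : ℝ → ℂ} (hu : IsWindowFunction a u)
    (hv : IsWindowFunction a v) :
    weilWindowForm a (u + v) - weilWindowForm a (u + (-1 : ℂ) • v) = 4 * (weilWindowSesq a u v).re := by
  have hv' : IsWindowFunction a ((-1 : ℂ) • v) := hv.smul (-1)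
  have h1 : (weilWindowForm a (u + v) : ℂ) = weilWindowSesq a (u + v) (u + v) := (weilWindowSesq_self a _).symm
  have h2 : (weilWindowForm a (u + (-1 : ℂ) • v) : ℂ) = weilWindowSesq a (u + (-1 : ℂ) • v) (u + (-1 : ℂ) • v) :=
    (weilWindowSesq_self a _).symm
  rw [weilWindowSesq_add_left ha hu hv (hu.add hv), weilWindowSesq_add_right ha hu hv hu,
    weilWindowSesq_add_right ha hu hv hv] at h1
  rw [weilWindowSesq_add_left ha hu hv' (hu.add hv'), weilWindowSesq_add_right ha hu hv' hu,
    weilWindowSesq_add_right ha hu hv' hv', weilWindowSesq_smul_left, weilWindowSesq_smul_right,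
    weilWindowSesq_smul_right, weilWindowSesq_smul_left] at h2
  have hvu : weilWindowSesq a v u = conj (weilWindowSesq a u v) := weilWindowSesq_conj_symm a u v
  rw [hvu] at h1 h2
  have key : ((weilWindowForm a (u + v) - weilWindowForm a (u + (-1 : ℂ) • v) : ℝ) : ℂ) =
      2 * (weilWindowSesq a u v + conj (weilWindowSesq a u v)) := by
    push_cast
    rw [h1, h2, map_neg, map_one]
    ring
  have hre := congrArg Complex.re key
  rw [Complex.ofReal_re] at hre
  rw [hre]
  simp only [Complex.mul_re, Complex.add_re, Complex.conj_re, Complex.add_im, Complex.conj_im]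
  norm_num
  ring

/-! ## The cross term of a representing measure is the sesquilinear window form -/

/-- The real parallelogram identity `Re(z·conj w) = (‖z + w‖² − ‖z − w‖²)/4`. -/
theorem re_mul_conj_eq_norm_sq_sub (z w : ℂ) :
    (z * conj w).re = (‖z + w‖ ^ 2 - ‖z + (-1 : ℂ) * w‖ ^ 2) / 4 := by
  rw [Complex.sq_norm, Complex.sq_norm, Complex.normSq_apply, Complex.normSq_apply]
  simp only [Complex.mul_re, Complex.conj_re, Complex.conj_im, Complex.add_re, Complex.add_im,
    Complex.mul_im, Complex.neg_re, Complex.neg_im, Complex.one_re, Complex.one_im]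
  ring

/-- **Polarisation, measure side.**  For window functions `u, v` smooth inside the window and `μ` representing
Weil's form on the tests of `[-a, a]`: `Re(û·conj v̂) ∈ L¹(μ)` and
`∫ Re(û(½+it)·conj v̂(½+it)) dμ = Re W_a(u, v)`. -/
theorem integral_re_weilMellin_mul_conj (ha : 0 < a) {μ : Measure ℝ}
    (hμ : ∀ g : ℝ → ℂ, IsWeilTest g → tsupport g ⊆ Icc (-a) a →
      Integrable (fun t : ℝ ↦ ‖weilMellin g (1 / 2 + t * I)‖ ^ 2) μ ∧
        weilQuadratic g = ((∫ t, ‖weilMellin g (1 / 2 + t * I)‖ ^ 2 ∂μ : ℝ) : ℂ))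
    {u v fu fv : ℝ → ℂ} (hu : IsWindowFunction a u) (hv : IsWindowFunction a v) (hfu : ContDiff ℝ ∞ fu)
    (hfv : ContDiff ℝ ∞ fv) (huf : ∀ x ∈ Icc (-a) a, u x = fu x) (hvf : ∀ x ∈ Icc (-a) a, v x = fv x) :
    Integrable (fun t : ℝ ↦ (weilMellin u (1 / 2 + t * I) * conj (weilMellin v (1 / 2 + t * I))).re) μ ∧
      ∫ t, (weilMellin u (1 / 2 + t * I) * conj (weilMellin v (1 / 2 + t * I))).re ∂μ =
        (weilWindowSesq a u v).re := by
  have hv' : IsWindowFunction a ((-1 : ℂ) • v) := hv.smul (-1)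
  obtain ⟨hiu, -⟩ := weilWindowForm_eq_integral ha hμ hu hfu huf
  obtain ⟨hiv, -⟩ := weilWindowForm_eq_integral ha hμ hv hfv hvf
  obtain ⟨hip, hp⟩ := weilWindowForm_eq_integral ha hμ (hu.add hv) (hfu.add hfv)
    (fun x hx ↦ by simp only [Pi.add_apply, huf x hx, hvf x hx])
  obtain ⟨him, hm⟩ := weilWindowForm_eq_integral ha hμ (hu.add hv') (hfu.add (hfv.const_smul (-1 : ℂ)))
    (fun x hx ↦ by simp only [Pi.add_apply, Pi.smul_apply, huf x hx, hvf x hx])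
  -- pointwise parallelogram: `4 Re(z conj w) = ‖z + w‖² − ‖z − w‖²`
  have hpt : ∀ t : ℝ, (weilMellin u (1 / 2 + t * I) * conj (weilMellin v (1 / 2 + t * I))).re =
      (‖weilMellin (u + v) (1 / 2 + t * I)‖ ^ 2 - ‖weilMellin (u + (-1 : ℂ) • v) (1 / 2 + t * I)‖ ^ 2) / 4 := by
    intro t
    rw [weilMellin_add_of_isWindowFunction hu hv, weilMellin_add_of_isWindowFunction hu hv', weilMellin_smul]
    exact re_mul_conj_eq_norm_sq_sub _ _
  have hfun : (fun t : ℝ ↦ (weilMellin u (1 / 2 + t * I) * conj (weilMellin v (1 / 2 + t * I))).re) =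
      fun t : ℝ ↦ (‖weilMellin (u + v) (1 / 2 + t * I)‖ ^ 2 - ‖weilMellin (u + (-1 : ℂ) • v) (1 / 2 + t * I)‖ ^ 2) / 4 := by
    funext t; exact hpt t
  rw [hfun]
  refine ⟨(hip.sub him).div_const 4, ?_⟩
  rw [integral_div, integral_sub hip him, ← hp, ← hm, weilWindowForm_add_sub_weilWindowForm_sub ha.le hu hv]
  ring

/-! ## The Beurling–Selberg window inequalities for a Weil measure -/

/-- **UPPER BEURLING–SELBERG WINDOW BOUND** (RH-free, every lattice window at every height).  For `a > 0`, every
positive `μ` representing Weil's form on the tests of `[-a, a]`, every `c ∈ ℝ` and every `N ∈ ℕ`, with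
`u_τ = e^{−iτx}χ_0` and the lattice heights `c + mπ/a`:

  `2a · μ[c, c + Nπ/a] ≤ Σ_{m=0}^{N} W_a(u_{c+mπ/a}) − (−1)^N · N · Re W_a(u_c, u_{c+Nπ/a})`. -/
theorem two_mul_mul_measureReal_Icc_le_selberg (ha : 0 < a) {μ : Measure ℝ}
    (hμ : ∀ g : ℝ → ℂ, IsWeilTest g → tsupport g ⊆ Icc (-a) a →
      Integrable (fun t : ℝ ↦ ‖weilMellin g (1 / 2 + t * I)‖ ^ 2) μ ∧
        weilQuadratic g = ((∫ t, ‖weilMellin g (1 / 2 + t * I)‖ ^ 2 ∂μ : ℝ) : ℂ)) (c : ℝ) (N : ℕ) :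
    2 * a * μ.real (Icc c (c + N * π / a)) ≤
      (∑ m ∈ Finset.range (N + 1), weilWindowForm a (fun x ↦ cexp (I * ((-(c + m * π / a)) * x : ℝ)) * chi a 0 x)) -
        (-1) ^ N * N * (weilWindowSesq a (fun x ↦ cexp (I * ((-c) * x : ℝ)) * chi a 0 x)
          (fun x ↦ cexp (I * ((-(c + N * π / a)) * x : ℝ)) * chi a 0 x)).re := by
  -- the pieces and their integrals
  have hW : ∀ τ : ℝ, Integrable (fun t : ℝ ↦ ‖weilMellin (fun x ↦ cexp (I * ((-τ) * x : ℝ)) * chi a 0 x) (1 / 2 + t * I)‖ ^ 2) μ ∧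
      weilWindowForm a (fun x ↦ cexp (I * ((-τ) * x : ℝ)) * chi a 0 x) =
        ∫ t, ‖weilMellin (fun x ↦ cexp (I * ((-τ) * x : ℝ)) * chi a 0 x) (1 / 2 + t * I)‖ ^ 2 ∂μ := by
    intro τ
    obtain ⟨hf, huf⟩ := modulated_chi_zero_smooth_inside a (-τ)
    exact weilWindowForm_eq_integral ha hμ (isWindowFunction_modulated_chi_zero ha (-τ)) hf huf
  obtain ⟨hfc, hufc⟩ := modulated_chi_zero_smooth_inside a (-c)
  obtain ⟨hfN, hufN⟩ := modulated_chi_zero_smooth_inside a (-(c + N * π / a))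
  obtain ⟨hXi, hX⟩ := integral_re_weilMellin_mul_conj ha hμ (isWindowFunction_modulated_chi_zero ha (-c))
    (isWindowFunction_modulated_chi_zero ha (-(c + N * π / a))) hfc hfN hufc hufN
  -- the majorant, pointwise
  set J : Set ℝ := Icc c (c + N * π / a) with hJ
  have h0 := measure_Icc_lt_top ha hμ c (c + N * π / a)
  have hind : Integrable (fun t : ℝ ↦ J.indicator (fun _ ↦ 2 * a) t) μ :=
    (integrable_indicator_iff measurableSet_Icc).2 (integrableOn_const h0.ne)
  have hle : ∀ t : ℝ, J.indicator (fun _ ↦ 2 * a) t ≤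
      (∑ m ∈ Finset.range (N + 1),
          ‖weilMellin (fun x ↦ cexp (I * ((-(c + m * π / a)) * x : ℝ)) * chi a 0 x) (1 / 2 + t * I)‖ ^ 2) -
        (-1) ^ N * N * (weilMellin (fun x ↦ cexp (I * ((-c) * x : ℝ)) * chi a 0 x) (1 / 2 + t * I) *
          conj (weilMellin (fun x ↦ cexp (I * ((-(c + N * π / a)) * x : ℝ)) * chi a 0 x) (1 / 2 + t * I))).re := by
    intro t
    set y : ℝ := a * (t - c) / π with hy
    have hπ := Real.pi_pos
    have hsel := indicator_Icc_le_selbergLattice N y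
    -- the indicators agree
    have hind_eq : J.indicator (fun _ ↦ 2 * a) t = 2 * a * (Icc (0 : ℝ) N).indicator (fun _ ↦ (1 : ℝ)) y := by
      by_cases ht : t ∈ J
      · have hy' : y ∈ Icc (0 : ℝ) N := by
          rw [hy]
          constructor
          · exact div_nonneg (mul_nonneg ha.le (by linarith [ht.1])) hπ.le
          · rw [div_le_iff₀ hπ]
            have := ht.2
            have h' : t - c ≤ N * π / a := by linarith
            calc a * (t - c) ≤ a * (N * π / a) := mul_le_mul_of_nonneg_left h' ha.le
              _ = N * π := by field_simp
        rw [indicator_of_mem ht, indicator_of_mem hy', mul_one]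
      · have hy' : y ∉ Icc (0 : ℝ) N := by
          intro hy'
          apply ht
          rw [hy] at hy'
          obtain ⟨h1, h2⟩ := hy'
          have h1' : 0 ≤ t - c := by
            by_contra hneg
            push Not at hneg
            have : a * (t - c) / π < 0 := div_neg_of_neg_of_pos (mul_neg_of_pos_of_neg ha hneg) hπ
            linarith
          rw [div_le_iff₀ hπ] at h2
          have h2' : t - c ≤ N * π / a := by
            rw [le_div_iff₀ ha]; linarith
          exact ⟨by linarith, by linarith⟩
        rw [indicator_of_notMem ht, indicator_of_notMem hy', mul_zero]
    -- the profiles agree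
    have hprof : ∀ m : ℕ, ‖weilMellin (fun x ↦ cexp (I * ((-(c + m * π / a)) * x : ℝ)) * chi a 0 x) (1 / 2 + t * I)‖ ^ 2 =
        2 * a * Real.sinc (π * (y - m)) ^ 2 := by
      intro m
      rw [norm_sq_weilMellin_modulated_eq_sinc_sq ha, hy]
      congr 2
      field_simp
      ring
    have hcross : (weilMellin (fun x ↦ cexp (I * ((-c) * x : ℝ)) * chi a 0 x) (1 / 2 + t * I) *
        conj (weilMellin (fun x ↦ cexp (I * ((-(c + N * π / a)) * x : ℝ)) * chi a 0 x) (1 / 2 + t * I))).re =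
        2 * a * (Real.sinc (π * y) * Real.sinc (π * (y - N))) := by
      rw [weilMellin_modulated_mul_conj ha, Complex.ofReal_re]
      have e1 : a * (t - c) = π * y := by rw [hy]; field_simp
      have e2 : a * (t - (c + N * π / a)) = π * (y - N) := by rw [hy]; field_simp; ring
      rw [e1, e2]; ring
    rw [hind_eq, Finset.sum_congr rfl fun m _ ↦ hprof m, hcross, ← Finset.mul_sum]
    have h2a : 0 ≤ 2 * a := by linarith
    nlinarith [hsel, h2a]
  -- integrate
  have hsumInt : Integrable (fun t : ℝ ↦ ∑ m ∈ Finset.range (N + 1),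
      ‖weilMellin (fun x ↦ cexp (I * ((-(c + m * π / a)) * x : ℝ)) * chi a 0 x) (1 / 2 + t * I)‖ ^ 2) μ :=
    integrable_finsetSum (Finset.range (N + 1)) fun m _ ↦ (hW (c + (m : ℝ) * π / a)).1
  calc 2 * a * μ.real J = ∫ t, J.indicator (fun _ ↦ 2 * a) t ∂μ := by
        rw [integral_indicator_const _ measurableSet_Icc, smul_eq_mul, mul_comm]
    _ ≤ ∫ t, ((∑ m ∈ Finset.range (N + 1),
          ‖weilMellin (fun x ↦ cexp (I * ((-(c + m * π / a)) * x : ℝ)) * chi a 0 x) (1 / 2 + t * I)‖ ^ 2) -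
        (-1) ^ N * N * (weilMellin (fun x ↦ cexp (I * ((-c) * x : ℝ)) * chi a 0 x) (1 / 2 + t * I) *
          conj (weilMellin (fun x ↦ cexp (I * ((-(c + N * π / a)) * x : ℝ)) * chi a 0 x) (1 / 2 + t * I))).re) ∂μ :=
        integral_mono hind (hsumInt.sub (hXi.const_mul _)) hle
    _ = _ := by
        rw [integral_sub hsumInt (hXi.const_mul _),
          integral_finsetSum (Finset.range (N + 1)) fun m _ ↦ (hW (c + (m : ℝ) * π / a)).1, integral_const_mul, hX]
        congr 1
        exact Finset.sum_congr rfl fun m _ ↦ (hW (c + (m : ℝ) * π / a)).2.symm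

/-- **LOWER BEURLING–SELBERG WINDOW BOUND** (RH-free, every lattice window at every height).  For `a > 0`, every
positive `μ` representing Weil's form on the tests of `[-a, a]`, every `c ∈ ℝ` and every `N ∈ ℕ`:

  `Σ_{m=1}^{N−1} W_a(u_{c+mπ/a}) − (−1)^N · N · Re W_a(u_c, u_{c+Nπ/a}) ≤ 2a · μ(c, c + Nπ/a)`. -/
theorem selberg_le_two_mul_mul_measureReal_Ioo (ha : 0 < a) {μ : Measure ℝ}
    (hμ : ∀ g : ℝ → ℂ, IsWeilTest g → tsupport g ⊆ Icc (-a) a →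
      Integrable (fun t : ℝ ↦ ‖weilMellin g (1 / 2 + t * I)‖ ^ 2) μ ∧
        weilQuadratic g = ((∫ t, ‖weilMellin g (1 / 2 + t * I)‖ ^ 2 ∂μ : ℝ) : ℂ)) (c : ℝ) (N : ℕ) :
    (∑ m ∈ Finset.Ico 1 N, weilWindowForm a (fun x ↦ cexp (I * ((-(c + m * π / a)) * x : ℝ)) * chi a 0 x)) -
        (-1) ^ N * N * (weilWindowSesq a (fun x ↦ cexp (I * ((-c) * x : ℝ)) * chi a 0 x)
          (fun x ↦ cexp (I * ((-(c + N * π / a)) * x : ℝ)) * chi a 0 x)).re ≤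
      2 * a * μ.real (Ioo c (c + N * π / a)) := by
  have hW : ∀ τ : ℝ, Integrable (fun t : ℝ ↦ ‖weilMellin (fun x ↦ cexp (I * ((-τ) * x : ℝ)) * chi a 0 x) (1 / 2 + t * I)‖ ^ 2) μ ∧
      weilWindowForm a (fun x ↦ cexp (I * ((-τ) * x : ℝ)) * chi a 0 x) =
        ∫ t, ‖weilMellin (fun x ↦ cexp (I * ((-τ) * x : ℝ)) * chi a 0 x) (1 / 2 + t * I)‖ ^ 2 ∂μ := by
    intro τ
    obtain ⟨hf, huf⟩ := modulated_chi_zero_smooth_inside a (-τ)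
    exact weilWindowForm_eq_integral ha hμ (isWindowFunction_modulated_chi_zero ha (-τ)) hf huf
  obtain ⟨hfc, hufc⟩ := modulated_chi_zero_smooth_inside a (-c)
  obtain ⟨hfN, hufN⟩ := modulated_chi_zero_smooth_inside a (-(c + N * π / a))
  obtain ⟨hXi, hX⟩ := integral_re_weilMellin_mul_conj ha hμ (isWindowFunction_modulated_chi_zero ha (-c))
    (isWindowFunction_modulated_chi_zero ha (-(c + N * π / a))) hfc hfN hufc hufN
  set J : Set ℝ := Ioo c (c + N * π / a) with hJ
  have h0 : μ J < ⊤ := lt_of_le_of_lt (measure_mono Ioo_subset_Icc_self) (measure_Icc_lt_top ha hμ c (c + N * π / a))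
  have hind : Integrable (fun t : ℝ ↦ J.indicator (fun _ ↦ 2 * a) t) μ :=
    (integrable_indicator_iff measurableSet_Ioo).2 (integrableOn_const h0.ne)
  have hle : ∀ t : ℝ,
      (∑ m ∈ Finset.Ico 1 N,
          ‖weilMellin (fun x ↦ cexp (I * ((-(c + m * π / a)) * x : ℝ)) * chi a 0 x) (1 / 2 + t * I)‖ ^ 2) -
        (-1) ^ N * N * (weilMellin (fun x ↦ cexp (I * ((-c) * x : ℝ)) * chi a 0 x) (1 / 2 + t * I) *
          conj (weilMellin (fun x ↦ cexp (I * ((-(c + N * π / a)) * x : ℝ)) * chi a 0 x) (1 / 2 + t * I))).re ≤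
      J.indicator (fun _ ↦ 2 * a) t := by
    intro t
    set y : ℝ := a * (t - c) / π with hy
    have hπ := Real.pi_pos
    have hsel := selbergLattice_le_indicator_Ioo N y
    have hind_eq : J.indicator (fun _ ↦ 2 * a) t = 2 * a * (Ioo (0 : ℝ) N).indicator (fun _ ↦ (1 : ℝ)) y := by
      by_cases ht : t ∈ J
      · have hy' : y ∈ Ioo (0 : ℝ) N := by
          rw [hy]
          constructor
          · exact div_pos (mul_pos ha (by linarith [ht.1])) hπ
          · rw [div_lt_iff₀ hπ]
            have h' : t - c < N * π / a := by linarith [ht.2]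
            calc a * (t - c) < a * (N * π / a) := mul_lt_mul_of_pos_left h' ha
              _ = N * π := by field_simp
        rw [indicator_of_mem ht, indicator_of_mem hy', mul_one]
      · have hy' : y ∉ Ioo (0 : ℝ) N := by
          intro hy'
          apply ht
          rw [hy] at hy'
          obtain ⟨h1, h2⟩ := hy'
          have h1' : 0 < t - c := by
            by_contra hneg
            push Not at hneg
            have : a * (t - c) / π ≤ 0 := div_nonpos_of_nonpos_of_nonneg (mul_nonpos_of_nonneg_of_nonpos ha.le hneg) hπ.le
            linarith
          rw [div_lt_iff₀ hπ] at h2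
          have h2' : t - c < N * π / a := by
            rw [lt_div_iff₀ ha]; linarith
          exact ⟨by linarith, by linarith⟩
        rw [indicator_of_notMem ht, indicator_of_notMem hy', mul_zero]
    have hprof : ∀ m : ℕ, ‖weilMellin (fun x ↦ cexp (I * ((-(c + m * π / a)) * x : ℝ)) * chi a 0 x) (1 / 2 + t * I)‖ ^ 2 =
        2 * a * Real.sinc (π * (y - m)) ^ 2 := by
      intro m
      rw [norm_sq_weilMellin_modulated_eq_sinc_sq ha, hy]
      congr 2
      field_simp
      ring
    have hcross : (weilMellin (fun x ↦ cexp (I * ((-c) * x : ℝ)) * chi a 0 x) (1 / 2 + t * I) *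
        conj (weilMellin (fun x ↦ cexp (I * ((-(c + N * π / a)) * x : ℝ)) * chi a 0 x) (1 / 2 + t * I))).re =
        2 * a * (Real.sinc (π * y) * Real.sinc (π * (y - N))) := by
      rw [weilMellin_modulated_mul_conj ha, Complex.ofReal_re]
      have e1 : a * (t - c) = π * y := by rw [hy]; field_simp
      have e2 : a * (t - (c + N * π / a)) = π * (y - N) := by rw [hy]; field_simp; ring
      rw [e1, e2]; ring
    rw [hind_eq, Finset.sum_congr rfl fun m _ ↦ hprof m, hcross, ← Finset.mul_sum]
    have h2a : 0 ≤ 2 * a := by linarith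
    nlinarith [hsel, h2a]
  have hsumInt : Integrable (fun t : ℝ ↦ ∑ m ∈ Finset.Ico 1 N,
      ‖weilMellin (fun x ↦ cexp (I * ((-(c + m * π / a)) * x : ℝ)) * chi a 0 x) (1 / 2 + t * I)‖ ^ 2) μ :=
    integrable_finsetSum (Finset.Ico 1 N) fun m _ ↦ (hW (c + (m : ℝ) * π / a)).1
  calc (∑ m ∈ Finset.Ico 1 N, weilWindowForm a (fun x ↦ cexp (I * ((-(c + m * π / a)) * x : ℝ)) * chi a 0 x)) -
        (-1) ^ N * N * (weilWindowSesq a (fun x ↦ cexp (I * ((-c) * x : ℝ)) * chi a 0 x)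
          (fun x ↦ cexp (I * ((-(c + N * π / a)) * x : ℝ)) * chi a 0 x)).re
      = ∫ t, ((∑ m ∈ Finset.Ico 1 N,
          ‖weilMellin (fun x ↦ cexp (I * ((-(c + m * π / a)) * x : ℝ)) * chi a 0 x) (1 / 2 + t * I)‖ ^ 2) -
        (-1) ^ N * N * (weilMellin (fun x ↦ cexp (I * ((-c) * x : ℝ)) * chi a 0 x) (1 / 2 + t * I) *
          conj (weilMellin (fun x ↦ cexp (I * ((-(c + N * π / a)) * x : ℝ)) * chi a 0 x) (1 / 2 + t * I))).re) ∂μ := by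
        rw [integral_sub hsumInt (hXi.const_mul _),
          integral_finsetSum (Finset.Ico 1 N) fun m _ ↦ (hW (c + (m : ℝ) * π / a)).1, integral_const_mul, hX]
        congr 1
        exact Finset.sum_congr rfl fun m _ ↦ (hW (c + (m : ℝ) * π / a)).2
    _ ≤ ∫ t, J.indicator (fun _ ↦ 2 * a) t ∂μ := integral_mono (hsumInt.sub (hXi.const_mul _)) hind hle
    _ = 2 * a * μ.real J := by
        rw [integral_indicator_const _ measurableSet_Ioo, smul_eq_mul, mul_comm]

end Summit.Ventures.WeilGRH

end
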